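import Summits.BirchSwinnertonDyer.BirchSwinnertonDyer.Theses.ResidualThetaTransportAtTwo
import Literature.NumberTheory.EllipticCurves.Kato2004.IwasawaH1LambdaTorsionFreeProofs
import Literature.NumberTheory.EllipticCurves.Kato2004.IwasawaCohomologyCoeffNewform
import HarnessLib


/-!
# Sketch (sidea k1·g12) — the WEAKEST PRINT HOLD: STUB-PLAN S63's «K0b census» executed in the kernel

Stub-ideation for `stub_cmLambdaLower : …Theses.ResidualThetaTransportAtTwo.ResidualSignedLambdaLowerCMAtTwo` (RSL_g,
stmt-BirchSwinnertonDyer-22608, BY NAME — never re-typed here).  Technique: weaken / strengthen, applied to the PRINT HOLD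
`stub_katoZetaCMAtTwo := K0a ∧ K0b ∧ KZ` of the registered line v2a «onepair»: `K0b = Kato2004.thm12_4_newform`
(`Module.Finite Λ_𝒪 I.H ∧ Module.IsTorsionFree Λ_𝒪 I.H ∧ Module.rank Λ_𝒪 I.H = 1`) is consumed by NOTHING in `_of`
(p682462 `…_of_parts hK0a hS3 hsup`); S63 asks, before the split, WHERE a Kato-12.4 fact would be used and whether the four S3
clauses already give it.  This file is the abstract algebra that SETTLES the census (all `R`-modules, `R` a commutative ring / domain):

* §1 `ker_iff_torsion` / `injective_iff_noTorsion`: for `φ : M →ₗ[R] P` with `P` torsion-free, `N ≤ M` with `M/N` torsion and `φ`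
  injective on `N`, one has **`ker φ = M_tors`** — so «`𝒸 ∘ locd₂` injective on `I.H`» (= `𝔖⁺(T) = 0`, V2A-PINS §5 (c), DAG N3, F-λ's
  `h𝒸`) is EQUIVALENT to «`I.H` has no `Λ`-torsion» = K0b clause 2, GIVEN (nz⁺) (injective on `N = Λ_𝒪 z`, §2) and (ii_fin)
  (`I.H/Λ_𝒪 z` torsion).  Neither K0b clause 1 (f.g.) nor clause 3 (rank 1) is ever needed.
* §1b `LambdaGlueTorsionKernel` (signature): F-λ's landed consumer `PlaceCutGlue.add_finrank_le_of_placeCut (h𝒸 : Injective 𝒸)` needs only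
  «`ker 𝒸` torsion» in `λ`-currency — the weakest sufficient form, K0b-free by §1.
* §2 `linearIndependent_of_rank_span_eq`: over a domain, `f` vectors whose span has rank `f` are independent — the kernel form of
  the critic's S63 sketch «(nz⁺) ⟹ `𝒸` injective on `Λ_𝒪 z`» (with `n = f`, U52), no K0b.
* §3 the INDEPENDENCE WITNESS: a toy `(M, N, φ)` satisfying every §1 hypothesis with `ker φ ≠ 0` — the S3 clauses (all `⊗ ℚ`-invariant)
  can NOT replace K0b clause 2; if a piece routes through `𝔖⁺(T) = 0` it MUST take torsion-freeness as an antecedent.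
* §4 the threading shape (pure logic): the piece takes `TF` (torsion-free) as antecedent, `_of` feeds it from the HOLD's `.2.1`.
* §5 (route-typed, PLAN 3 = the strongest PROVABLE form): the tree already PROVES Kato 12.4 (2), first half, for the `ℤ_p`-pin of
  `T_pE` (`Kato2004.IwasawaH1Data.isTorsionFree`, input: `E(ℚ_∞)[p^∞]` finite); typed here are the port target for the coefficient
  pin `IwasawaH1DataCoeff ρ.toGaloisRep p κ γ` (H3, statement only), the local input at `2` (H3-loc, Imai 1975, statement only) and the
  PROVED transport `kerFixed_finite_of_theta`: RSL_g's own binders `Θ`, `hΘ` + H3-loc ⟹ H3's finiteness input.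

Nothing here asserts RSL_g, (R≥)ᵖ or any Kato fact; BSD is NOT proved by any of this.
-/

open scoped NumberField
open Field IsDedekindDomain CongruenceSubgroup
open Literature.NumberTheory.GaloisRepresentations
open Literature.NumberTheory.EllipticCurves Literature.NumberTheory.EllipticCurves.ModularForms
open Literature.NumberTheory.EllipticCurves.Kato2004 Literature.NumberTheory.EllipticCurves.GreenbergSelmer


namespace Summit.BirchSwinnertonDyer.BirchSwinnertonDyer.Cruxes.ResidualThetaCountLowerPureAtTwo.SideaK1G12

/-! ## §1 `ker φ = torsion` — the identity behind «𝔖⁺(T) = 0 ⟺ K0b clause 2» -/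

section KerTorsion

variable {R : Type*} [CommRing R] {M P : Type*} [AddCommGroup M] [Module R M] [AddCommGroup P] [Module R P]

/-- L1.  `φ : M → P` linear, `P` without `R`-torsion (`r • y = 0 → r = 0 ∨ y = 0`), `N ≤ M` with `M/N` torsion
(`∀ m, ∃ r ≠ 0, r • m ∈ N`) and `φ` injective on `N`.  Then `φ m = 0 ↔ m` is a torsion element.
(In the supply: `M = I.H`, `N = Λ_𝒪 z`, `φ = 𝒸 ∘ locd₂`, `P = ℤ₂⟦X⟧ⁿ`; `M/N` torsion ⟸ (ii_fin); injective on `N` ⟸ (nz⁺), §2.) -/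
theorem ker_iff_torsion (φ : M →ₗ[R] P) (N : Submodule R M)
    (hP : ∀ (r : R) (y : P), r • y = 0 → r = 0 ∨ y = 0)
    (hMN : ∀ m : M, ∃ r : R, r ≠ 0 ∧ r • m ∈ N)
    (hφN : ∀ n ∈ N, φ n = 0 → n = 0) (m : M) :
    φ m = 0 ↔ ∃ r : R, r ≠ 0 ∧ r • m = 0 := by
  constructor
  · intro hm
    obtain ⟨r, hr, hrm⟩ := hMN m
    refine ⟨r, hr, hφN _ hrm ?_⟩
    rw [map_smul, hm, smul_zero]
  · rintro ⟨r, hr, hrm⟩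
    have h : r • φ m = 0 := by rw [← map_smul, hrm, map_zero]
    rcases hP r (φ m) h with h0 | h0
    · exact absurd h0 hr
    · exact h0

/-- L1′ (the census verdict).  Under the same hypotheses, `φ` is injective iff `M` has no `R`-torsion.  READ: given (nz⁺) + (ii_fin),
«`𝒸 ∘ locd₂` injective on `I.H`» (`𝔖⁺(T) = 0`) ⟺ «`I.H` torsion-free» (= `Kato2004.thm12_4_newform`, clause 2) — so a piece that uses
`𝔖⁺(T) = 0` needs EXACTLY K0b's torsion-free clause, and a piece that does not use it needs no K0b at all. -/
theorem injective_iff_noTorsion (φ : M →ₗ[R] P) (N : Submodule R M)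
    (hP : ∀ (r : R) (y : P), r • y = 0 → r = 0 ∨ y = 0)
    (hMN : ∀ m : M, ∃ r : R, r ≠ 0 ∧ r • m ∈ N)
    (hφN : ∀ n ∈ N, φ n = 0 → n = 0) :
    Function.Injective φ ↔ ∀ (r : R) (m : M), r • m = 0 → r = 0 ∨ m = 0 := by
  constructor
  · intro hinj r m hrm
    have h : r • φ m = 0 := by rw [← map_smul, hrm, map_zero]
    rcases hP r (φ m) h with h0 | h0
    · exact Or.inl h0
    · exact Or.inr (hinj (by rw [h0, map_zero]))
  · intro hM
    rw [← LinearMap.ker_eq_bot, Submodule.eq_bot_iff]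
    intro m hm
    rw [LinearMap.mem_ker] at hm
    obtain ⟨r, hr, hrm⟩ := (ker_iff_torsion φ N hP hMN hφN m).1 hm
    rcases hM r m hrm with h0 | h0
    · exact absurd h0 hr
    · exact h0

/-- L1″ (one direction needs nothing): if `M` embeds linearly into a torsion-free `P`, `M` is torsion-free — so torsion-freeness of
`I.H` is not only sufficient but NECESSARY for `𝔖⁺(T) = 0`; no clause of S3 can manufacture it (§3). -/
theorem noTorsion_of_injective (φ : M →ₗ[R] P) (hP : ∀ (r : R) (y : P), r • y = 0 → r = 0 ∨ y = 0)
    (hinj : Function.Injective φ) : ∀ (r : R) (m : M), r • m = 0 → r = 0 ∨ m = 0 := by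
  intro r m hrm
  have h : r • φ m = 0 := by rw [← map_smul, hrm, map_zero]
  rcases hP r (φ m) h with h0 | h0
  · exact Or.inl h0
  · exact Or.inr (hinj (by rw [h0, map_zero]))

/-- L1‴ (rank-1 clause is REDUNDANT): with `M/N` torsion and `N = R ∙ z` cyclic, every `m : M` is a torsion element modulo `R ∙ z` —
i.e. `M` has rank ≤ 1 «up to torsion»; this is all the λ-bookkeeping of the supply uses, and it is (ii_fin), not K0b clause 3. -/
theorem exists_smul_mem_span_singleton (z : M) (hMN : ∀ m : M, ∃ r : R, r ≠ 0 ∧ r • m ∈ R ∙ z) (m : M) :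
    ∃ (r s : R), r ≠ 0 ∧ r • m = s • z := by
  obtain ⟨r, hr, hrm⟩ := hMN m
  obtain ⟨s, hs⟩ := Submodule.mem_span_singleton.1 hrm
  exact ⟨r, s, hr, hs.symm⟩

end KerTorsion

/-! ## §1b The WEAKEST SUFFICIENT FORM for F-λ's by-name consumer (signature only) -/

section LambdaGlueWeak

open scoped TensorProduct

/-- H2b (signature only; size S–M for a prover).  `PlaceCutGlue.finrank_baseChange_quotient_map_eq_add` /
`add_finrank_le_of_placeCut` (p684598 §3, the corank road F-λ) take `h𝒸 : Function.Injective 𝒸` on ALL of `𝐇¹` — by L1′ that is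
K0b clause 2.  In `λ`-currency (after `K ⊗[A] −`) the torsion kernel is invisible, so the identity survives with `h𝒸` weakened to
«`ker 𝒸` is `A`-torsion», which L1 delivers from (nz⁺) + (ii_fin) with NO K0b.  Proof route: apply the landed lemma to
`H̄ := H ⧸ ker 𝒸` (`𝒸̄ := (ker 𝒸).liftQ 𝒸` injective, `H̄str := Hstr.map mkQ`, same `Hstr.map 𝒸` and `range 𝒸`), and
`K ⊗ (H ⧸ Hstr) ≅ K ⊗ (H̄ ⧸ H̄str)` because the kernel `(Hstr ⊔ ker 𝒸) ⧸ Hstr` is torsion and `K ⊗ (torsion) = 0` (right exactness). -/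
def LambdaGlueTorsionKernel : Prop :=
  ∀ (A : Type) [CommRing A] [IsDomain A] (K : Type) [Field K] [Algebra A K] [IsFractionRing A K]
    (H L : Type) [AddCommGroup H] [Module A H] [AddCommGroup L] [Module A L]
    (𝒸 : H →ₗ[A] L) (Hstr : Submodule A H),
    (∀ x : H, 𝒸 x = 0 → ∃ a : A, a ≠ 0 ∧ a • x = 0) →
    ∀ [Module.Finite K (K ⊗[A] (L ⧸ Hstr.map 𝒸))],
      Module.finrank K (K ⊗[A] (L ⧸ Hstr.map 𝒸)) =
        Module.finrank K (K ⊗[A] (H ⧸ Hstr)) + Module.finrank K (K ⊗[A] (L ⧸ LinearMap.range 𝒸))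

end LambdaGlueWeak

/-! ## §2 (nz⁺) ⟹ injective on `Λ_𝒪 z`: full-rank span over a domain forces independence (no K0b) -/

section FullRankSpan

variable {R : Type*} [CommRing R] [IsDomain R] {P : Type*} [AddCommGroup P] [Module R P]

/-- L2.  Over a commutative domain: if `f` vectors span a submodule of rank `f`, they are linearly independent.
READ (critic's S63 sketch, kernel form): `v i := 𝒸 (locd₂ (b i • z))` for a `ℤ₂⟦X⟧`-basis `b` of `Λ_𝒪` (`f` of them); (nz⁺) says their
`ℤ₂⟦X⟧`-span has finite `ℤ₂`-corank in `ℤ₂⟦X⟧ⁿ`, hence rank `n`, and `n = f` (U52); so the `v i` are independent, i.e. `𝒸 ∘ locd₂` is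
injective on `Λ_𝒪 z = ⊕ ℤ₂⟦X⟧ · bᵢ z` and `z` is non-torsion — WITHOUT `thm12_4_newform`. -/
theorem linearIndependent_of_rank_span_eq {f : ℕ} (v : Fin f → P)
    (hv : Module.rank R (Submodule.span R (Set.range v)) = f) : LinearIndependent R v := by
  rw [linearIndependent_iff_card_eq_finrank_span, Set.finrank, Module.finrank, hv]
  simp

end FullRankSpan

/-! ## §3 Independence witness: the §1 hypotheses do NOT give `ker φ = 0` — torsion-freeness must ARRIVE (K0b clause 2) -/

section Witness

/-- The toy: `R = ℤ`, `M = ℤ × ZMod 2`, `N = ℤ ∙ (1, 0)`, `φ = fst`.  `M/N` is torsion (killed by `2`), `φ` is injective on `N`, the target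
`ℤ` is torsion-free — and `ker φ ∋ (0, 1) ≠ 0`.  So «(nz⁺) + (ii_fin) ⟹ 𝔖⁺(T) = 0» is FALSE as algebra: the S3 clauses are blind to
`Λ`-torsion in `I.H`, exactly as L1 predicts (`ker φ = M_tors`). -/
theorem witness_hypotheses :
    (∀ (r : ℤ) (y : ℤ), r • y = 0 → r = 0 ∨ y = 0) ∧
    (∀ m : ℤ × ZMod 2, ∃ r : ℤ, r ≠ 0 ∧ r • m ∈ ℤ ∙ ((1, 0) : ℤ × ZMod 2)) ∧
    (∀ n ∈ ℤ ∙ ((1, 0) : ℤ × ZMod 2), LinearMap.fst ℤ ℤ (ZMod 2) n = 0 → n = 0) := by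
  refine ⟨fun r y h => mul_eq_zero.1 (by simpa using h), fun m => ⟨2, two_ne_zero, ?_⟩, ?_⟩
  · refine Submodule.mem_span_singleton.2 ⟨2 * m.1, ?_⟩
    ext
    · simp [mul_comm]
    · have h2 : (2 : ZMod 2) = 0 := by decide
      simp [h2]
  · intro n hn h0
    obtain ⟨a, rfl⟩ := Submodule.mem_span_singleton.1 hn
    have ha : a = 0 := by simpa using h0
    subst ha; simp

theorem witness_kernel_ne_bot :
    ∃ m : ℤ × ZMod 2, m ≠ 0 ∧ LinearMap.fst ℤ ℤ (ZMod 2) m = 0 ∧ (2 : ℤ) • m = 0 := by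
  refine ⟨(0, 1), ?_, rfl, ?_⟩
  · intro h; have := congrArg Prod.snd h; exact absurd this (by decide)
  · ext
    · simp
    · have h2 : (2 : ZMod 2) = 0 := by decide
      simp [h2]

end Witness

/-! ## §4 Threading shape (pure logic): the WEAKEST antecedent is K0b's clause 2 alone, fed from the HOLD -/

section Threading

/-- If a split piece `SUP` needs torsion-freeness `TF`, type it as `TF → SUP`; `_of` feeds `TF` from the HOLD's K0b conjunct
(`(stub_katoZetaCMAtTwo.2.1 2 M g ι ρ κ γ hnew hρ hκ hγ I).2.1`) and p682462 `_of_parts` is reused VERBATIM. -/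
theorem crux_of_threaded {K0a K0b KZ TF SUP RSL : Prop} (of_parts : K0a → KZ → SUP → RSL)
    (hold : K0a ∧ K0b ∧ KZ) (clause₂ : K0b → TF) (hsup : TF → SUP) : RSL :=
  of_parts hold.1 hold.2.2 (hsup (clause₂ hold.2.1))

/-- If NO piece needs it (PLAN 2: both place-cut halves from Poitou–Tate annihilators with `H := H_Σ(T) = I.H`), K0b is dead weight in
the HOLD: `_of` never touches `.2.1` (S63: docstring «carried for coherence» or drop at the P2′ re-type). -/
theorem crux_of_unthreaded {K0a K0b KZ SUP RSL : Prop} (of_parts : K0a → KZ → SUP → RSL)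
    (hold : K0a ∧ K0b ∧ KZ) (hsup : SUP) : RSL :=
  of_parts hold.1 hold.2.2 hsup

end Threading


/-! ## §5 PLAN 3 — the strongest PROVABLE form of K0b clause 2 (route-typed) -/

section StrongestProvable

/-- H3 (PLAN 3 port target, statement only): torsion-freeness of the COEFFICIENT pin from the finiteness of the tower-fixed cofree
points — `Kato2004.IwasawaH1Data.isTorsionFree` with `ℤ_p ↦ 𝒪 = padicCoeffIntegers (Set.range ι)`, `T_pW ↦ ρ`,
`E(ℚ_∞)[p^∞] finite ↦ (Cofree ρ)^{ker κ} finite`.  With it, K0b clause 2 stops being a print HOLD for the habitat's `ρ`. -/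
def CoeffPinTorsionFreeOfTowerFinite : Prop :=
  ∀ (p : ℕ) [Fact p.Prime] (M : ℕ) [NeZero M] (g : CuspForm (Gamma0 M) 2) (ι : coeffField g →+* PadicAlgCl p)
    (ρ : FramedGaloisRep ℚ (padicCoeffIntegers (Set.range ι)) 2) (κ : ZpExtension ℚ p) (γ : absoluteGaloisGroup ℚ),
    κ.IsTopGenerator γ →
    Set.Finite {m : Cofree ρ ↥(padicCoeffField (Set.range ι)) | ∀ τ : absoluteGaloisGroup ℚ, τ ∈ κ.kerSubgroup → τ • m = m} →
      ∀ I : IwasawaH1DataCoeff ρ.toGaloisRep p κ γ, Module.IsTorsionFree (IwasawaAlgebraO (Set.range ι)) I.H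

/-- H3-loc (PLAN 3 local input, statement only; Imai 1975 for `W/ℚ₂` with good reduction): at a place `v ∣ 2`, the `2`-primary
torsion of `W` fixed by the local image of `ker κ` (= `Gal(ℚ̄₂/ℚ_{2,∞})`) is finite. -/
def LocalTowerTorsionFiniteAt (W : WeierstrassCurve ℚ) [W.IsElliptic] {p : ℕ} [Fact p.Prime] (κ : ZpExtension ℚ p)
    (v : HeightOneSpectrum (𝓞 ℚ)) : Prop :=
  Set.Finite {P : ↥(W.geomPrimaryTorsion p) |
    ∀ δ : absoluteGaloisGroup (v.adicCompletion ℚ),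
      resGalOfEmb (closureEmb (K := ℚ) (v.adicCompletion ℚ)) δ ∈ κ.kerSubgroup →
        resGalOfEmb (closureEmb (K := ℚ) (v.adicCompletion ℚ)) δ • P = P}

/-- H3-transport (PROVED): under RSL_g's binders `Θ v hv : Cofree ρ ≃+ (Fin n → W[2^∞])` and its `G_{ℚ_v}`-equivariance `hΘ`,
local finiteness at one `v ∣ 2` gives the finiteness of the globally tower-fixed cofree points (the input of H3):
`(Cofree ρ)^{ker κ} ↪ (W[2^∞]^{ker κ ∩ G_{ℚ_v}})ⁿ`. -/
theorem towerFixed_finite_of_theta (W : WeierstrassCurve ℚ) [W.IsElliptic]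
    {M : ℕ} [NeZero M] (g : CuspForm (Gamma0 M) 2) (ι : coeffField g →+* PadicAlgCl 2)
    (κ : ZpExtension ℚ 2) (n : ℕ) (ρ : FramedGaloisRep ℚ (padicCoeffIntegers (Set.range ι)) 2)
    (v : HeightOneSpectrum (𝓞 ℚ)) (hv : ((2 : ℕ) : 𝓞 ℚ) ∈ v.asIdeal)
    (Θ : ∀ v : HeightOneSpectrum (𝓞 ℚ), ((2 : ℕ) : 𝓞 ℚ) ∈ v.asIdeal →
      (Cofree ρ ↥(padicCoeffField (Set.range ι)) ≃+ (Fin n → ↥(W.geomPrimaryTorsion 2))))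
    (hΘ : ∀ v hv (δ : absoluteGaloisGroup (v.adicCompletion ℚ)) m i,
      Θ v hv (resGalOfEmb (closureEmb (K := ℚ) (v.adicCompletion ℚ)) δ • m) i =
        resGalOfEmb (closureEmb (K := ℚ) (v.adicCompletion ℚ)) δ • Θ v hv m i)
    (hloc : LocalTowerTorsionFiniteAt W κ v) :
    Set.Finite {m : Cofree ρ ↥(padicCoeffField (Set.range ι)) |
      ∀ δ : absoluteGaloisGroup (v.adicCompletion ℚ),
        resGalOfEmb (closureEmb (K := ℚ) (v.adicCompletion ℚ)) δ ∈ κ.kerSubgroup →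
          resGalOfEmb (closureEmb (K := ℚ) (v.adicCompletion ℚ)) δ • m = m} := by
  classical
  -- the locally-tower-fixed cofree points embed, via `Θ v hv`, into the finite set of `n`-tuples of locally-tower-fixed torsion points
  have hpi : Set.Finite (Set.pi Set.univ fun _ : Fin n =>
      {P : ↥(W.geomPrimaryTorsion 2) | ∀ δ : absoluteGaloisGroup (v.adicCompletion ℚ),
        resGalOfEmb (closureEmb (K := ℚ) (v.adicCompletion ℚ)) δ ∈ κ.kerSubgroup →
          resGalOfEmb (closureEmb (K := ℚ) (v.adicCompletion ℚ)) δ • P = P}) :=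
    Set.Finite.pi fun _ => hloc
  refine Set.Finite.of_finite_image (f := fun m => Θ v hv m) (hpi.subset ?_) ?_
  · rintro _ ⟨m, hm, rfl⟩
    simp only [Set.mem_pi, Set.mem_univ, Set.mem_setOf_eq, forall_true_left]
    intro i δ hδ
    rw [← hΘ v hv δ m i, hm δ hδ]
  · exact (Θ v hv).injective.injOn


/-- H3-transport, global form (PROVED): the `ker κ`-fixed cofree points — EXACTLY the finiteness input of H3
`CoeffPinTorsionFreeOfTowerFinite` — are finite under RSL_g's `Θ`, `hΘ` and the local input H3-loc at one `v ∣ 2`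
(globally fixed ⊆ locally-tower-fixed). So PLAN 3 = H3 (port of the tree's §A–§F engine to `𝒪`-coefficients) + H3-loc (Imai). -/
theorem kerFixed_finite_of_theta (W : WeierstrassCurve ℚ) [W.IsElliptic]
    {M : ℕ} [NeZero M] (g : CuspForm (Gamma0 M) 2) (ι : coeffField g →+* PadicAlgCl 2)
    (κ : ZpExtension ℚ 2) (n : ℕ) (ρ : FramedGaloisRep ℚ (padicCoeffIntegers (Set.range ι)) 2)
    (v : HeightOneSpectrum (𝓞 ℚ)) (hv : ((2 : ℕ) : 𝓞 ℚ) ∈ v.asIdeal)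
    (Θ : ∀ v : HeightOneSpectrum (𝓞 ℚ), ((2 : ℕ) : 𝓞 ℚ) ∈ v.asIdeal →
      (Cofree ρ ↥(padicCoeffField (Set.range ι)) ≃+ (Fin n → ↥(W.geomPrimaryTorsion 2))))
    (hΘ : ∀ v hv (δ : absoluteGaloisGroup (v.adicCompletion ℚ)) m i,
      Θ v hv (resGalOfEmb (closureEmb (K := ℚ) (v.adicCompletion ℚ)) δ • m) i =
        resGalOfEmb (closureEmb (K := ℚ) (v.adicCompletion ℚ)) δ • Θ v hv m i)
    (hloc : LocalTowerTorsionFiniteAt W κ v) :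
    Set.Finite {m : Cofree ρ ↥(padicCoeffField (Set.range ι)) |
      ∀ τ : absoluteGaloisGroup ℚ, τ ∈ κ.kerSubgroup → τ • m = m} :=
  (towerFixed_finite_of_theta W g ι κ n ρ v hv Θ hΘ hloc).subset fun m hm δ hδ => hm _ hδ

end StrongestProvable

end Summit.BirchSwinnertonDyer.BirchSwinnertonDyer.Cruxes.ResidualThetaCountLowerPureAtTwo.SideaK1G12
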